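import Literature.AnabelianGeometry.AbsoluteAnabelian.AbsTopIII.BiAnabelianCompatibility
import Literature.AnabelianGeometry.AbsoluteAnabelian.AbsTopIII.BiAnabelianTelecoreIncompatibilityIff
import Literature.AnabelianGeometry.AbsoluteAnabelian.AbsTopIII.BiAnabelianModelProofs
import Literature.AnabelianGeometry.AbsoluteAnabelian.DiagramShiftInvariance

/-!
# [AbsTopIII] Cor. 3.7 (v), final sentence AS TYPED BY GEN 5 (`ShiftCompatStmt θ`) is REFUTED at the model

[cite: MochizukiAbsTopIII2015, Cor 3.7 (iv) p.88] [cite: MochizukiAbsTopIII2015, Cor 3.7 (v) p.88]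
[cite: MochizukiAbsTopIII2015, Lemma 3.4 p.74]

abc-iut-L4-t5 (gen 6): KERNEL CERTIFICATE of finding F-L4t5g6-1 «COR37v-REALISESALL» on the typer's own gen-5
statement `BiAnabelianSetting.ShiftCompatStmt θ` (`BiAnabelianCompatibility.lean`, p445222).  That statement
quantifies ONE family of homotopies `K` on `𝒟*` with `RealisesAll θ K`: `K` contains the `𝔖†_log` family (along
`𝒟†_{≤3} ↪ 𝒟*`), the core families, the family `𝒥` of SOME telecore `𝔗_δ` of the printed shape (along
`𝒟‡_δ ↪ 𝒟*`) AND a family `ℋ_δ` with the printed generators `θ_{□⋎}`, `θ_⋎`.  Print (iv), second sentence — "the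
telecore structure `𝔗_δ`, the family of homotopies `ℋ_δ`, and the observable `𝔖†_log` are not simultaneously
compatible" — says no such `K` exists at print's data.  We prove, for EVERY abstract setting and EVERY `θ^bi`:

* `starLogPinned_of_compatibleAlong_embLog`, `deltaPinned_of_compatibleAlong_id`,
  `exists_isIso_telePair_of_compatibleAlong_embTele` — a family realising `𝔖†_log` / `ℋ_δ` / a delta-shaped
  telecore carries the pinned homotopies `ι_×`, `ι_{log,⋎}` / `θ_{□⋎}`, `θ_⋎` / an INVERTIBLE homotopy on the
  telecore pair `([δ_0], [δ_0]∘[π_0]∘[log_𝒳]∘[δ_1])` (the telecore family is symmetric; for a general delta-shaped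
  `𝔗_δ` this homotopy need not be the identity that abc-iut-L4-t9's `TelePinned` demands, so abc-iut-f-074's
  exact criterion is not applicable verbatim);
* `exists_iso_lamTimes_iotaLog_eq_iotaTimes_of_pinned` — abc-iut-f-074's two-routes computation
  (`iotaTimes_eq_of_pinned`) REPLAYED with an invertible telecore homotopy `τ`: the pinned data force
  `λ^×(pr(τ_{x₀}) ≫ ℓ_{x₀}⁻¹) ≫ ι_{log,x₀} = ι_{×,x₀}` with `pr(τ_{x₀}) ≫ ℓ⁻¹` an ISOMORPHISM `x₀ ⥲ log x₀`;
* hence `not_realisesAll_of_logKernelObstruction`, `not_shiftCompatStmt_of_logKernelObstruction`: under the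
  Lemma-3.4 obstruction (abc-iut-L4-t9's `LogKernelObstruction`: at some `x₀`, no isomorphism `a : x₀ ⥲ log x₀`
  has `λ^×(a) ≫ ι_log = ι_×`) NO family realises all, so `ShiftCompatStmt θ` FAILS; at the MLF model
  (`TFModel.modelSetting_logKernelObstruction`): **`TFModel.not_shiftCompatStmt_modelSetting`**.

The successor statement is `ShiftCompatStmt′ θ` of `BiAnabelianCompatibilityShift.lean` (the Cor. 3.6 split:
one family for the (iii) collection, one for `𝔗_δ` with `ℋ_δ`).  HONEST FRAMING: refuted-AS-TYPED (a statement
of this cell), NOT a statement about print, which (iv) makes consistent only in the split reading; model-level;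
nothing here bears on [IUTchIII] Cor. 3.12.
-/

set_option autoImplicit false

namespace Literature.AnabelianGeometry.AbsoluteAnabelian

open _root_.CategoryTheory _root_.Quiver

universe u

/-! ## Transport of natural transformations across heterogeneous equality (bookkeeping) -/

/-- A natural transformation heterogeneously equal to a PINNED one (components `eqToHom ≫ ι ≫ eqToHom` between
functors equal to the given ones) is pinned in the same way. [folklore] -/
private theorem NatTrans.pinned_of_heq {C D : Type*} [Category C] [Category D] {P Q P' Q' F G : C ⥤ D}
    {α : P ⟶ Q} {β : P' ⟶ Q'} (ι : F ⟶ G) (hP : P = P') (hQ : Q = Q') (h : HEq α β)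
    (hα : ∀ (x : C) (e₁ : P.obj x = F.obj x) (e₂ : Q.obj x = G.obj x),
      α.app x = eqToHom e₁ ≫ ι.app x ≫ eqToHom e₂.symm)
    (x : C) (e₁ : P'.obj x = F.obj x) (e₂ : Q'.obj x = G.obj x) :
    β.app x = eqToHom e₁ ≫ ι.app x ≫ eqToHom e₂.symm := by
  subst hP hQ
  obtain rfl := eq_of_heq h
  exact hα x e₁ e₂

/-- Invertibility passes along a heterogeneous equality of morphisms between equal objects. [folklore] -/
private theorem isIso_of_heq {C : Type*} [Category C] {P Q P' Q' : C} {α : P ⟶ Q} {β : P' ⟶ Q'} (hP : P = P')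
    (hQ : Q = Q') (h : HEq α β) (hα : IsIso α) : IsIso β := by
  subst hP hQ
  obtain rfl := eq_of_heq h
  exact hα

namespace AbsTopIII.BiAnabelianSetting

open DiagramOfCategories

variable {X E N : Type u} [Category.{u} X] [Category.{u} E] [Category.{u} N]
  (𝔖 : BiAnabelianSetting X E N) (θ : FiberSquare.BiAnabelianLift 𝔖.gal)

/-! ## The presentations ARE pulled-back diagrams -/

/-- `𝒟†_{≤3} = 𝒟†_{≤2} ∪ {𝒩}` IS `embLog^*𝒟*`. [cite: MochizukiAbsTopIII2015, Cor 3.7 (iii) p.88] -/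
theorem logObsDiagram_eq_comapAlong : 𝔖.logObsDiagram = 𝔖.starDiagram.comapAlong embLog :=
  𝔖.starDiagram.eq_comapAlong embLog (fun a => by rcases a with _ | _ <;> rfl)
    (fun a => by rcases a with _ | _ <;> exact HEq.rfl)
    (fun e => by
      rename_i a b
      revert e
      rcases a with ⟨_ | _ | _ | _ | _, _⟩ | _ <;> rcases b with ⟨_ | _ | _ | _ | _, _⟩ | _ <;> intro e <;>
        first | exact (PEmpty.elim e) | exact HEq.rfl | (rcases e with ⟨_ | _⟩ <;> exact HEq.rfl))

/-- Hence the path functors of `𝒟†_{≤3}` are those of `𝒟*` along `embLog` (heterogeneously).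
[cite: MochizukiAbsTopIII2015, Cor 3.7 (iii) p.88] -/
theorem logObsDiagram_pathFunctor_heq {a b : logObsShape.{u}.Vertex} (p : Path a b) :
    HEq (𝔖.logObsDiagram.pathFunctor p) (𝔖.starDiagram.pathFunctor (embLog.mapPath p)) :=
  (pathFunctor_heq_of_eq 𝔖.logObsDiagram_eq_comapAlong p).trans
    (heq_of_eq (𝔖.starDiagram.pathFunctor_comapAlong embLog p))

section Telecore

variable {𝔖}
variable {H₁ : ((𝔖.daggerLe 1).extend 𝔖.refCoreExt).HomotopyFamily}
  {hH₁ : ∀ ⦃a b : refCoreShape.{u}.Vertex⦄ ⦃p q : Path a b⦄, H₁.E p q → b = refCoreShape.{u}.obs}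
  {hc : (𝔖.refCoreObs H₁ hH₁).IsCore}

/-- The diagram of a telecore OF THE PRINTED SHAPE over the `𝒳`-core IS `embTele^*𝒟*` (telecore edges carry
`δ_𝒳`). [cite: MochizukiAbsTopIII2015, Cor 3.7 (ii) p.87] -/
theorem teleDiagram_eq_comapAlong_of_isTelecoreDelta {T : (𝔖.daggerLe 1).Telecore (𝔖.refCoreObs H₁ hH₁) hc}
    (hT : IsTelecoreDelta T) : teleDiagram T = 𝔖.starDiagram.comapAlong (embTele T) :=
  𝔖.starDiagram.eq_comapAlong (embTele T) (fun a => by rcases a with _ | _ <;> rfl)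
    (fun a => by rcases a with _ | _ <;> exact HEq.rfl)
    (fun e => by
      rename_i a b
      revert e
      rcases a with ⟨_ | _ | _ | _ | _, ha⟩ | _ <;> rcases b with ⟨_ | _ | _ | _ | _, hb⟩ | _ <;> intro e <;>
        first
          | exact (PEmpty.elim e)
          | exact HEq.rfl
          | exact heq_of_eq (hT.telMap_eq _ e)
          | exact absurd hb.2 (by decide)
          | exact absurd rfl hb.1)

/-- Hence its path functors are those of `𝒟*` along `embTele` (heterogeneously).
[cite: MochizukiAbsTopIII2015, Cor 3.7 (ii) p.87] -/
theorem teleDiagram_pathFunctor_heq_of_isTelecoreDelta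
    {T : (𝔖.daggerLe 1).Telecore (𝔖.refCoreObs H₁ hH₁) hc} (hT : IsTelecoreDelta T)
    {a b : ExtShape.Vertex ⟨refCoreShape.{u}.I, T.J⟩} (p : Path a b) :
    HEq ((teleDiagram T).pathFunctor p) (𝔖.starDiagram.pathFunctor ((embTele T).mapPath p)) :=
  (pathFunctor_heq_of_eq (teleDiagram_eq_comapAlong_of_isTelecoreDelta hT) p).trans
    (heq_of_eq (𝔖.starDiagram.pathFunctor_comapAlong (embTele T) p))

/-- **A family containing the family `𝒥` of a delta-shaped telecore carries an INVERTIBLE homotopy on the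
telecore pair `([δ_0], [δ_0]∘[π_0]∘[log_𝒳]∘[δ_1])`** (a core-suffix pair of `𝒟‡_δ`; `𝒥` is symmetric, so its
homotopies are isomorphisms). [cite: MochizukiAbsTopIII2015, Cor 3.7 (ii) p.87] -/
theorem exists_isIso_telePair_of_compatibleAlong_embTele
    {T : (𝔖.daggerLe 1).Telecore (𝔖.refCoreObs H₁ hH₁) hc} (hT : IsTelecoreDelta T)
    {K : 𝔖.starDiagram.HomotopyFamily} (hJ : T.Jfam.CompatibleAlong (embTele T) K) :
    ∃ h : K.E (deltaPath.{u} 0) (telePath.{u} 0), IsIso (K.η h) := by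
  obtain ⟨j0⟩ := hT.nonempty_J 0
  obtain ⟨j1⟩ := hT.nonempty_J (0 + 1)
  let O : ExtShape.Vertex ⟨refCoreShape.{u}.I, T.J⟩ := ExtShape.obs _
  let eJ0 : O ⟶ tv T 0 := show ExtShape.obs ⟨refCoreShape.{u}.I, T.J⟩ ⟶ tv T 0 from j0
  let eJ1 : O ⟶ tv T (0 + 1) := show ExtShape.obs ⟨refCoreShape.{u}.I, T.J⟩ ⟶ tv T (0 + 1) from j1
  let eLg : tv T (0 + 1) ⟶ tv T 0 :=
    show tv T (0 + 1) ⟶ tv T 0 from (Cor37Edge.log.{u} (0 + 1) 0 rfl : Cor37Vertex.first (0 + 1) ⟶ .first 0)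
  let eI0 : tv T 0 ⟶ O := show tv T 0 ⟶ ExtShape.obs ⟨refCoreShape.{u}.I, T.J⟩ from PUnit.unit
  let pT : Path O (tv T 0) := (Path.nil : Path O O).cons eJ0
  let q₁ : Path O O := (((Path.nil : Path O O).cons eJ1).cons eLg).cons eI0
  let qT : Path O (tv T 0) := q₁.cons eJ0
  have hE : T.Jfam.E pT qT := (T.boundary_iff pT qT).2 ⟨Path.nil, q₁, pT, rfl, rfl⟩
  have hE' : T.Jfam.E qT pT := (T.boundary_iff qT pT).2 ⟨q₁, Path.nil, pT, rfl, rfl⟩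
  have hiso : IsIso (T.Jfam.η hE) :=
    ⟨⟨T.Jfam.η hE', by rw [← T.Jfam.η_trans hE hE', T.Jfam.η_refl],
      by rw [← T.Jfam.η_trans hE' hE, T.Jfam.η_refl]⟩⟩
  obtain ⟨h', hη⟩ := hJ pT qT hE
  have hP : (teleDiagram T).pathFunctor pT = 𝔖.starDiagram.pathFunctor ((embTele T).mapPath pT) :=
    eq_of_heq (teleDiagram_pathFunctor_heq_of_isTelecoreDelta hT pT)
  have hQ : (teleDiagram T).pathFunctor qT = 𝔖.starDiagram.pathFunctor ((embTele T).mapPath qT) :=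
    eq_of_heq (teleDiagram_pathFunctor_heq_of_isTelecoreDelta hT qT)
  exact ⟨h', isIso_of_heq hP hQ hη hiso⟩

end Telecore

/-! ## A family containing `𝔖†_log` / `ℋ_δ` carries their pinned homotopies -/

/-- **A family containing an `𝔖†_log` family along `𝒟†_{≤3} ↪ 𝒟*` contains the pinned `ι_×`, `ι_{log,⋎}`**
(abc-iut-L4-t9's `StarLogPinned`). [cite: MochizukiAbsTopIII2015, Cor 3.7 (iii) p.88] -/
theorem starLogPinned_of_compatibleAlong_embLog {K : 𝔖.starDiagram.HomotopyFamily}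
    {H : 𝔖.logObsDiagram.HomotopyFamily} (hH : 𝔖.IsLogObservableFamily H) (hK : H.CompatibleAlong embLog K) :
    𝔖.StarLogPinned K := by
  obtain ⟨-, -, ⟨hT, hhT⟩, hL⟩ := hH
  refine ⟨?_, fun n => ?_⟩
  · obtain ⟨h', hη⟩ := hK _ _ hT
    refine ⟨h', fun x e₁ e₂ => ?_⟩
    exact NatTrans.pinned_of_heq 𝔖.iotaTimes (eq_of_heq (𝔖.logObsDiagram_pathFunctor_heq timesPairLeft))
      (eq_of_heq (𝔖.logObsDiagram_pathFunctor_heq timesPairRight)) hη hhT x e₁ e₂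
  · obtain ⟨h, hh⟩ := hL n
    obtain ⟨h', hη⟩ := hK _ _ h
    refine ⟨h', fun o e₁ e₂ => ?_⟩
    exact NatTrans.pinned_of_heq 𝔖.iotaLogAt (eq_of_heq (𝔖.logObsDiagram_pathFunctor_heq (logPairLeft n)))
      (eq_of_heq (𝔖.logObsDiagram_pathFunctor_heq (logPairRight n))) hη (fun o e₁ e₂ => hh o e₁ e₂) o e₁ e₂

/-- **A family containing `ℋ_δ` (along the identity of `Γ⃗_{𝒟*}`) contains the pinned generators `θ_{□⋎}`,
`θ_⋎`** (abc-iut-L4-t9's `DeltaPinned θ`). [cite: MochizukiAbsTopIII2015, Cor 3.7 (ii) p.88] -/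
theorem deltaPinned_of_compatibleAlong_id {K Hδ : 𝔖.starDiagram.HomotopyFamily} (hδ : 𝔖.DeltaPinned θ Hδ)
    (hK : Hδ.CompatibleAlong (𝟭q Cor37Vertex) K) : 𝔖.DeltaPinned θ K := by
  obtain ⟨hbox, htheta⟩ := hδ
  refine ⟨fun n => ?_, fun n => ?_⟩
  · obtain ⟨h, hh⟩ := hbox n
    obtain ⟨h', hη⟩ := hK _ _ h
    refine ⟨h', fun x e => ?_⟩
    have hηeq : Hδ.η h = K.η h' := eq_of_heq hη
    exact (congrArg (fun τ => NatTrans.app τ x) hηeq).symm.trans (hh x e)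
  · obtain ⟨h, hh⟩ := htheta n
    obtain ⟨h', hη⟩ := hK _ _ h
    refine ⟨h', fun o e₁ e₂ => ?_⟩
    have hηeq : Hδ.η h = K.η h' := eq_of_heq hη
    exact (congrArg (fun τ => NatTrans.app τ o) hηeq).symm.trans (hh o e₁ e₂)

/-! ## The two routes of the proof of (iv) with an invertible telecore homotopy -/

/-- **abc-iut-f-074's `iotaTimes_eq_of_pinned` with an INVERTIBLE (not necessarily identity) telecore
homotopy.**  Inside ONE family on `𝒟*` containing `θ_{□⋎}`, `θ_⋎` (pinned), an invertible homotopy `τ` on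
`([δ_0], [δ_0]∘[π_0]∘[log_𝒳]∘[δ_1])` and the pinned `ι_×`, `ι_{log,⋎}`, the two routes
`[λ^×]∘[δ_□] ⇝ [λ^{×pf}]∘[pr_1]∘[δ_1]` (proof of Cor 3.6 (iv) p. 82, read for `𝒟*`) have equal homotopies, whence
`ι_{×,x₀} = λ^×(pr(τ_{x₀}) ≫ (θ^bi)⁻¹) ≫ ι_{log,x₀}` with `(θ^bi)⁻¹ = ℓ_{x₀}⁻¹` (`θbi_inv_app_logSq_diag`) — an
ISOMORPHISM `x₀ ⥲ log x₀`. [cite: MochizukiAbsTopIII2015, Cor 3.7 (iv) p.88] -/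
theorem exists_iso_lamTimes_iotaLog_eq_iotaTimes_of_pinned (K : 𝔖.starDiagram.HomotopyFamily)
    (hΔ : 𝔖.DeltaPinned θ K) (hT : ∃ h : K.E (deltaPath.{u} 0) (telePath.{u} 0), IsIso (K.η h))
    (hSL : 𝔖.StarLogPinned K) (x₀ : X) :
    ∃ a : x₀ ⟶ 𝔖.log.obj x₀, IsIso a ∧ 𝔖.lamTimes.map a ≫ 𝔖.iotaLog.app x₀ = 𝔖.iotaTimes.app x₀ := by
  obtain ⟨hA, hG⟩ := hΔ
  obtain ⟨⟨hTm, hhTm⟩, hL⟩ := hSL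
  obtain ⟨hA0, hhA0⟩ := hA 0
  obtain ⟨hA1, hhA1⟩ := hA (0 + 1)
  obtain ⟨hG0, hhG0⟩ := hG 0
  obtain ⟨hT0, hiso⟩ := hT
  obtain ⟨hL0, hhL0⟩ := hL 0
  -- the edges of `Γ⃗_{𝒟*}` that occur (`⋎ = 0`, `⋎ + 1 = 0 + 1`)
  let d0 : (Cor37Vertex.ref ⟶ Cor37Vertex.first 0) := Cor37Edge.diag.{u} 0
  let d1 : (Cor37Vertex.ref ⟶ Cor37Vertex.first (0 + 1)) := Cor37Edge.diag.{u} (0 + 1)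
  let p0 : (Cor37Vertex.first 0 ⟶ Cor37Vertex.box) := Cor37Edge.pr.{u} 0
  let p1 : (Cor37Vertex.first (0 + 1) ⟶ Cor37Vertex.box) := Cor37Edge.pr.{u} (0 + 1)
  let lg : (Cor37Vertex.first (0 + 1) ⟶ Cor37Vertex.first 0) := Cor37Edge.log.{u} (0 + 1) 0 rfl
  let lt : (Cor37Vertex.box ⟶ Cor37Vertex.space) := Cor37Edge.lamTimes.{u}
  let lp : (Cor37Vertex.box ⟶ Cor37Vertex.space) := Cor37Edge.lamTimesPf.{u}
  -- the paths from the core vertex `𝒳` to `𝒩` visited by the two routes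
  let PBt : Path Cor37Vertex.ref Cor37Vertex.space := deltaBoxPath.{u}.cons lt
  let PBp : Path Cor37Vertex.ref Cor37Vertex.space := deltaBoxPath.{u}.cons lp
  let R : Path Cor37Vertex.ref Cor37Vertex.space := (prDeltaPath.{u} (0 + 1)).cons lp
  let Q0t : Path Cor37Vertex.ref Cor37Vertex.space := (prDeltaPath.{u} 0).cons lt
  let TPpt : Path Cor37Vertex.ref Cor37Vertex.space := ((telePath.{u} 0).cons p0).cons lt
  let L : Path Cor37Vertex.ref Cor37Vertex.space :=
    ((((Path.nil : Path Cor37Vertex.ref .ref).cons d1).cons lg).cons p0).cons lt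
  -- route 1: `ι_×` behind `[δ_□]`, then `θ_{□,⋎+1}` followed by `[λ^{×pf}]`
  have s1 : K.E PBt PBp := K.isSaturated.precomp (K.isSaturated.postcomp hTm Path.nil) deltaBoxPath.{u}
  have s2 : K.E PBp R :=
    K.isSaturated.precomp (K.isSaturated.postcomp hA1 ((Path.nil : Path Cor37Vertex.box .box).cons lp))
      Path.nil
  have r1 : K.E PBt R := K.isSaturated.trans s1 s2
  -- route 2: `θ_{□⋎}` then `[λ^×]`; telecore homotopy then `[pr_⋎]`, `[λ^×]`; `θ_⋎` whiskered; `ι_{log,⋎}`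
  -- behind `[δ_{⋎+1}]`
  have s3 : K.E PBt Q0t :=
    K.isSaturated.precomp (K.isSaturated.postcomp hA0 ((Path.nil : Path Cor37Vertex.box .box).cons lt))
      Path.nil
  have s4 : K.E Q0t TPpt :=
    K.isSaturated.precomp (K.isSaturated.postcomp hT0
      (((Path.nil : Path (Cor37Vertex.first 0) (.first 0)).cons p0).cons lt)) Path.nil
  have s5 : K.E TPpt L :=
    K.isSaturated.precomp (K.isSaturated.postcomp hG0
      (((Path.nil : Path (Cor37Vertex.first 0) (.first 0)).cons p0).cons lt))
      (((Path.nil : Path Cor37Vertex.ref .ref).cons d1).cons lg)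
  have s6 : K.E L R :=
    K.isSaturated.precomp (K.isSaturated.postcomp hL0 Path.nil)
      ((Path.nil : Path Cor37Vertex.ref .ref).cons d1)
  have t34 : K.E PBt TPpt := K.isSaturated.trans s3 s4
  have t345 : K.E PBt L := K.isSaturated.trans t34 s5
  have r2 : K.E PBt R := K.isSaturated.trans t345 s6
  -- strict components of the pinned homotopies
  have P_Tm : ∀ y : X, K.strictApp hTm y = 𝟙 _ ≫ 𝔖.iotaTimes.app y ≫ 𝟙 _ := fun y =>
    K.strictApp_pin hTm (F := 𝔖.lamTimes) (G := 𝔖.lamTimesPf) rfl rfl 𝔖.iotaTimes hhTm y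
  have P_A1 : ∀ y : X, K.strictApp hA1 y = 𝟙 _ := fun y => K.strictApp_pinId hA1 hhA1 y rfl
  have P_A0 : ∀ y : X, K.strictApp hA0 y = 𝟙 _ := fun y => K.strictApp_pinId hA0 hhA0 y rfl
  have P_G0 : ∀ o : 𝔖.Sq, K.strictApp hG0 o = 𝟙 _ ≫ θ.thetaX.hom.app o ≫ 𝟙 _ := fun o =>
    K.strictApp_pin hG0 (F := 𝔖.proj ⋙ 𝔖.diag) (G := 𝟭 _) rfl rfl θ.thetaX.hom hhG0 o
  have P_L0 : ∀ o : 𝔖.Sq, K.strictApp hL0 o = 𝟙 _ ≫ 𝔖.iotaLogAt.app o ≫ 𝟙 _ := fun o =>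
    K.strictApp_pin hL0 (F := 𝔖.logSq ⋙ 𝔖.pr ⋙ 𝔖.lamTimes) (G := 𝔖.pr ⋙ 𝔖.lamTimesPf) rfl rfl
      𝔖.iotaLogAt (fun o e₁ e₂ => hhL0 o e₁ e₂) o
  -- the invertible telecore homotopy, strict component at `x₀`
  let τ := K.strictApp hT0 x₀
  have hτ : IsIso τ := by
    have : IsIso ((K.η hT0).app x₀) := inferInstance
    change IsIso (eqToHom _ ≫ (K.η hT0).app x₀ ≫ eqToHom _)
    infer_instance
  -- strict components of the six whiskered homotopies at `x₀`
  have W1 : K.strictApp s1 x₀ = 𝟙 _ ≫ (𝟙 _ ≫ 𝔖.iotaTimes.app x₀ ≫ 𝟙 _) ≫ 𝟙 _ := by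
    have := K.strictApp_whisker hTm deltaBoxPath.{u} Path.nil x₀
    rw [P_Tm] at this
    exact this
  have W2 : K.strictApp s2 x₀ = 𝟙 _ ≫ 𝔖.lamTimesPf.map (𝟙 x₀) ≫ 𝟙 _ := by
    have := K.strictApp_whisker hA1 Path.nil ((Path.nil : Path Cor37Vertex.box .box).cons lp) x₀
    rw [P_A1] at this
    exact this
  have W3 : K.strictApp s3 x₀ = 𝟙 _ ≫ 𝔖.lamTimes.map (𝟙 x₀) ≫ 𝟙 _ := by
    have := K.strictApp_whisker hA0 Path.nil ((Path.nil : Path Cor37Vertex.box .box).cons lt) x₀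
    rw [P_A0] at this
    exact this
  have W4 : K.strictApp s4 x₀ = 𝟙 _ ≫ 𝔖.lamTimes.map (𝔖.pr.map τ) ≫ 𝟙 _ := by
    have := K.strictApp_whisker hT0 Path.nil
      (((Path.nil : Path (Cor37Vertex.first 0) (.first 0)).cons p0).cons lt) x₀
    exact this
  have W5 : K.strictApp s5 x₀ = 𝟙 _ ≫
      𝔖.lamTimes.map (𝔖.pr.map (𝟙 _ ≫ θ.thetaX.hom.app (𝔖.logSq.obj (𝔖.diag.obj x₀)) ≫ 𝟙 _)) ≫
      𝟙 _ := by
    have := K.strictApp_whisker hG0 (((Path.nil : Path Cor37Vertex.ref .ref).cons d1).cons lg)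
      (((Path.nil : Path (Cor37Vertex.first 0) (.first 0)).cons p0).cons lt) x₀
    rw [P_G0] at this
    exact this
  have W6 : K.strictApp s6 x₀ = 𝟙 _ ≫ (𝟙 _ ≫ 𝔖.iotaLog.app x₀ ≫ 𝟙 _) ≫ 𝟙 _ := by
    have := K.strictApp_whisker hL0 ((Path.nil : Path Cor37Vertex.ref .ref).cons d1) Path.nil x₀
    rw [P_L0] at this
    exact this
  -- the two routes are homotopies of the same pair, hence equal
  have key : K.strictApp s1 x₀ ≫ K.strictApp s2 x₀ =
      ((K.strictApp s3 x₀ ≫ K.strictApp s4 x₀) ≫ K.strictApp s5 x₀) ≫ K.strictApp s6 x₀ := by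
    rw [← K.strictApp_trans s1 s2 r1 x₀, ← K.strictApp_trans s3 s4 t34 x₀,
      ← K.strictApp_trans t34 s5 t345 x₀, ← K.strictApp_trans t345 s6 r2 x₀]
  rw [W1, W2, W3, W4, W5, W6] at key
  simp only [Category.id_comp, Category.comp_id, Limits.CategoricalPullback.π₁_map,
    FiberSquare.BiAnabelianLift.thetaX_hom_app_fst, Category.assoc] at key
  -- the identities `λ^×(𝟙)`, `λ^{×pf}(𝟙)` and `(θ^bi)⁻¹` at `log_𝒳(δ_𝒳 x₀)` (= `ℓ⁻¹_{x₀}`, `θbi_inv_app_logSq_diag`)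
  erw [CategoryTheory.Functor.map_id, CategoryTheory.Functor.map_id, Category.comp_id, Category.id_comp,
    𝔖.θbi_inv_app_logSq_diag θ] at key
  -- `τ` is invertible in `𝒳 ×_𝔈 𝒳`, hence so is its first component
  have hτ' : @IsIso 𝔖.Sq _ _ _ τ := hτ
  have hfst : IsIso (Limits.CategoricalPullback.Hom.fst τ) := by
    have h1 : IsIso (𝔖.pr.map τ) := inferInstance
    exact h1
  have hinv : IsIso (𝔖.logIsoId.inv.app x₀) := inferInstance
  refine ⟨Limits.CategoricalPullback.Hom.fst τ ≫ 𝔖.logIsoId.inv.app x₀,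
    @IsIso.comp_isIso _ _ _ _ _ _ _ hfst hinv, ?_⟩
  rw [Functor.map_comp, Category.assoc]
  exact key.symm

/-! ## Consequences: `RealisesAll`, `ShiftCompatStmt` fail under the Lemma-3.4 obstruction -/

/-- **Under the Lemma-3.4 obstruction NO family on `𝒟*` realises cores, `𝔖†_log`, a delta-shaped telecore and `ℋ_δ`
at once** (the gen-5 `RealisesAll θ K` is unsatisfiable) — Cor 3.7 (iv), second sentence, in the form the typed (v)
needs. [cite: MochizukiAbsTopIII2015, Cor 3.7 (iv) p.88] -/
theorem not_realisesAll_of_logKernelObstruction (hobs : 𝔖.LogKernelObstruction)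
    (K : 𝔖.starDiagram.HomotopyFamily) : ¬ 𝔖.RealisesAll θ K := by
  rintro ⟨⟨⟨H, hH, hHK⟩, -, -, -⟩, ⟨H₁, hH₁, hc, T, hT, hJ⟩, ⟨Hδ, -, hδ, hδK⟩⟩
  obtain ⟨x₀, hx₀⟩ := hobs
  obtain ⟨a, ha, h⟩ := 𝔖.exists_iso_lamTimes_iotaLog_eq_iotaTimes_of_pinned θ K
    (𝔖.deltaPinned_of_compatibleAlong_id θ hδ hδK) (exists_isIso_telePair_of_compatibleAlong_embTele hT hJ)
    (𝔖.starLogPinned_of_compatibleAlong_embLog hH hHK) x₀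
  exact hx₀ a ha h

/-- **`ShiftCompatStmt θ` AS TYPED BY GEN 5 FAILS under the Lemma-3.4 obstruction** (finding F-L4t5g6-1; the
successor is `ShiftCompatStmt′ θ`). [cite: MochizukiAbsTopIII2015, Cor 3.7 (v) p.88] -/
theorem not_shiftCompatStmt_of_logKernelObstruction (hobs : 𝔖.LogKernelObstruction) :
    ¬ 𝔖.ShiftCompatStmt θ := by
  rintro ⟨Φ, K, -, hK, -⟩
  exact 𝔖.not_realisesAll_of_logKernelObstruction θ hobs K hK

/-- The same from the typed SECOND INCOMPATIBILITY's exact criterion being met in the strong form "no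
isomorphism `x₀ ⥲ log x₀` works at some `x₀`" — recorded as the implication from `LogKernelObstruction`; the
converse direction (a family realising all ⇒ `LogCoreKernel`) would need the naturality of `τ` in `x₀`.
-- TODO(general form): `RealisesAll θ K → 𝔖.LogCoreKernel` (assemble `x ↦ pr(τ_x) ≫ ℓ_x⁻¹` into `𝟭 ≅ log`).
[cite: MochizukiAbsTopIII2015, Cor 3.7 (iv) p.88] -/
theorem shiftCompatStmt_imp_not_logKernelObstruction (h : 𝔖.ShiftCompatStmt θ) : ¬ 𝔖.LogKernelObstruction :=
  fun hobs => 𝔖.not_shiftCompatStmt_of_logKernelObstruction θ hobs h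

end AbsTopIII.BiAnabelianSetting

/-! ## At the MLF model -/

namespace AbsTopIII.TFModel

variable (p : ℕ) [Fact p.Prime]

/-- **At the model `TFModel.modelSetting p` of MLF-Galois `T𝔽`-pairs, `ShiftCompatStmt θ` (gen 5) is FALSE for every
bi-anabelian lift datum** (Lemma 3.4: `TFModel.modelSetting_logKernelObstruction`) — the kernel certificate of
finding F-L4t5g6-1; the repaired statement is `ShiftCompatStmt′`. [cite: MochizukiAbsTopIII2015, Cor 3.7 (v) p.88] -/
theorem not_shiftCompatStmt_modelSetting (θ : FiberSquare.BiAnabelianLift (modelSetting p).gal) :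
    ¬ Literature.AnabelianGeometry.AbsoluteAnabelian.AbsTopIII.BiAnabelianSetting.ShiftCompatStmt
      (modelSetting p) θ :=
  (modelSetting p).not_shiftCompatStmt_of_logKernelObstruction θ (modelSetting_logKernelObstruction p)

/-- Likewise NO family on the model's `𝒟*` realises all four structures (for any `θ^bi`).
[cite: MochizukiAbsTopIII2015, Cor 3.7 (iv) p.88] -/
theorem not_realisesAll_modelSetting (θ : FiberSquare.BiAnabelianLift (modelSetting p).gal)
    (K : (modelSetting p).starDiagram.HomotopyFamily) :
    ¬ Literature.AnabelianGeometry.AbsoluteAnabelian.AbsTopIII.BiAnabelianSetting.RealisesAll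
      (modelSetting p) θ K :=
  (modelSetting p).not_realisesAll_of_logKernelObstruction θ (modelSetting_logKernelObstruction p) K

end AbsTopIII.TFModel

end Literature.AnabelianGeometry.AbsoluteAnabelian
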